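import Summits.QuantumFields.YangMills.Theorems.FluctuationComparisonRegPrIntLOrganTangentJTSqOfHdisp
import HarnessLib

/-!
# Crux `FluctuationComparisonRegPrIntL` (stmt-QuantumFields-20520, rung R3), PATH-B organ — «(JT-h)sq, NEAR (I-curv) EDITION»: the (JT-h) door with the curvature square
# clause stated ONLY AT THE OBSERVABLE's OWN SQUARE (law point a corner) — TN-ICURV-FAR, LEAD RULING №51 amendment A1 «(I-curv)sq» (DEFINITION-FREE)

Cell `ym3-torus` (YM ladder rung R3 = continuum `SU(2)` Yang–Mills on the three-torus — a RUNG: NOT d = 4, NOT infinite volume, NOT a mass gap, NOT Clay).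
Width seat `ym-ust-20520-w3` (gen 27, LEAD-20520 organ-tangent lane); `--kind proof --supports stmt-QuantumFields-20520 --as helper`, count-neutral, no registry ∕ binder ∕
`Lines/` edit, default heartbeats, `autoImplicit false`.  Over ✓p819158 `…JTOfCornerStability` (px19 g21), ✓p819624 `…JTSqOfHdisp` (px19 g21), px20 g21
✓`…NearStability.hstab_corners_of_hdisp`, ✓`…PullbackSquareCurvOrgan.hClauseSq_of_curvSquare` ∕ ✓`…PullbackSquareCurv.abs_rectDiff_le_curvLetters`.

WHY (TN-ICURV-FAR, LEAD `ym-ust-20520-w3` g27 №1).  In the frozen rows «b» (`OrganDischargeInputsHJ`, ✓p818968) and row-sq v0.1 (`OrganDischargeInputsHJsq`, workfile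
aadbac2d) the (I-curv) group's differential curvature square clause `hcurv` quantifies the square's BASE `X` over the whole `θ_j∕4`-window INDEPENDENTLY of the law point
`Xw`, and the crude clause `hcrude` likewise quantifies its square `(U V W Y)` freely — two FAR-PAIR clauses of the same class as «b»'s window-to-window letter `hglobW`
(TN-HGLOB-FRAME: at a fibre point `z` that is good for `Xw`, nothing in print's frames confines `Φ(X^{sq}, z)` for a far base `X` to the regularity window of `ρ_Ts`).  Their ONLY
consumer, the (JT-h) door ✓p819158 (:161 → ✓`hClauseSq_of_curvSquare` :137), instantiates the clause at the observable square `(U; B m; B′ m′)` alone, and in the near-pair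
edition the law point is a corner of that square.  This file is the door's NEAR (I-curv) edition: the curvature clause is a hypothesis ONLY for squares having `Xw` among their
corners (one added antecedent, A1's row text character for character), everything else as ✓p819158 ∕ ✓p819624.

WHAT.  ★`hClauseSq_of_curvData` — ONE-square edition of ✓`hClauseSq_of_curvSquare`: the (s2) derivative data `F₂ F₁₂ α α′ γ′` AT the square `(U; b v; b′ v′)` ⟹
`|RT Z − RT V − RT W + RT U| ≤ (Σ_{p q} KP p b·k̃ p q·KP q b′ + Σ_p g̃ p·KP2 p b b′)·(‖v‖∕θc)·(‖v′‖∕θc)` at its relational corners.  ★★`jtBracket_of_cornerStability_near` —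
✓p819158 with (γ) replaced by (γ-near): the clause carries the extra antecedent «`Xw` is a corner of the square `(X; b v; b′ v′)`» and the door the hypothesis `hXwc : Xw ∈ {U,V,W,Y}`;
CONCLUSION character-exact.  ★★★`jtBracket_sq_of_hdisp_near` — ∘ ✓`hstab_corners_of_hdisp` (= ✓p819624 with (γ-near)): the knit-sq v0.2 (JT-h)sq line.

HONEST FRAMING: a re-cut of landed bookkeeping over HYPOTHESIS clauses; `hdisp`, the near curvature square clause, the crude letter and the tail are HYPOTHESES ([Balaban1985Variational]
Thm 1 (9)–(10), Prop 9 (190); [Balaban1987RG1] (0.22)–(0.25) are the print inputs, NOT constructed here); nothing of Bałaban's analysis is asserted or proved;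
`SpreadFibreLawH(J)(sq)` ∕ `OrganDischargeInputsHJ(sq)` UNDISCHARGED; LIN″, JEN″, JVARᵘ-H″, O1ᵘ-H v2.2, S1aᴴ, S3ᴴ, S2α′, S2β, 26243, the five registered stubs of
`Lines/semiclassical_s2beta.lean` (3732b7df, untouched), crux 20520 `FluctuationComparisonRegPrIntL` and `YM3TorusSU2` are NOT proved; rung R3 = SU(2) YM₃ on T³ at fixed lattice
data — NOT d = 4, NOT infinite volume, NOT a mass gap, NOT Clay; the Yang–Mills mass gap is NOT proved.  [folklore]
-/

set_option autoImplicit false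

noncomputable section

namespace Summit.QuantumFields.YangMills.Theorems.OrganTangentJTSqOfHdispNear

open MeasureTheory Filter Topology Function Set
open scoped ENNReal NNReal BigOperators
open Literature.MathematicalPhysics.QuantumFieldTheory.Balaban1983to89 T3ContinuumYM3Torus T3NestedUnitLaws
  T3UnitLawDensityEML T4Continuum BalabanUVClass T3UnitScaleTilt T3LevelShift T3TiltDescent
open T4CubeChartExp (expPt)
open Summit.QuantumFields.YangMills.Theorems.FluctuationComparisonRegPrIntLRunpairOrganFibreLaw (mwCut wNum wgt)
open Summit.QuantumFields.YangMills.Theorems.OrganTangentFibreWeightNormalisation (wgt_normalised)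
open Summit.QuantumFields.YangMills.Theorems.OrganTangentFibreWeightSquareIntegrability (integrable_logRatio_mul_wgt_of_squareStability)
open Summit.QuantumFields.YangMills.Theorems.OrganTangentSecondDiffIntegration (abs_integral_secondDiff_mul_le_good_add_tail secondDiff_letter_bound)
open Summit.QuantumFields.YangMills.Theorems.OrganTangentPullbackSquareCurv (abs_rectDiff_le_curvLetters)
open Summit.QuantumFields.YangMills.Theorems.OrganTangentPullbackSquareCurvOrgan (letterSum_sizes_eq sqCorner_one_zero sqCorner_zero_one sqCorner_one_one)
open Summit.QuantumFields.YangMills.Theorems.OrganTangentSeedHClause (eq_update_of_rel corner_zero_zero)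
open Summit.QuantumFields.YangMills.Theorems.OrganTangentJTOfCurvatureTransport (wgt_interp_nonneg)
open Summit.QuantumFields.YangMills.Theorems.OrganTangentNearStability (hstab_corners_of_hdisp)

/-! ## §1 ★ The bracket bound at ONE square from the (s2) derivative data AT that square -/

/-- ★ **ONE-SQUARE EDITION of ✓`hClauseSq_of_curvSquare`.**  The (s2) differential curvature data of `RT` along the organ's one-bond exponential square at `(U; b v; b′ v′)` —
`F₂` (the `t`-derivative on the edges `s = 0`, `s = 1`), `F₁₂` (its `s`-derivative), profiles `0 ≤ α ≤ KP p b·(‖v‖∕θc)`, `0 ≤ α′ ≤ KP q b′·(‖v′‖∕θc)`,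
`0 ≤ γ′ ≤ KP2 p b b′·(‖v‖∕θc)·(‖v′‖∕θc)` and the structured bound `|F₁₂| ≤ Σ α·k̃·α′ + Σ g̃·γ′` — bounds the second difference of `RT` over the relational corners
`V = U·e^{v}@b`, `W = U·e^{v′}@b′`, `Z = V·e^{v′}@b′` by the curvature letter `(Σ_{p q} KP p b·k̃ p q·KP q b′ + Σ_p g̃ p·KP2 p b b′)·(‖v‖∕θc)·(‖v′‖∕θc)`.
(✓`abs_rectDiff_le_curvLetters` + corner identities; the `∀`-square hypothesis of ✓`hClauseSq_of_curvSquare` is NOT needed.) [folklore] -/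
theorem hClauseSq_of_curvData {P : Params} {j : ℕ} {ιP : Type*} [Fintype ιP] {θc : ℝ}
    (RT : GaugeField P j (Matrix.specialUnitaryGroup (Fin 2) ℂ) → ℝ)
    (kP : ιP → ιP → ℝ) (gP : ιP → ℝ) (KP : ιP → PBond P j → ℝ) (KP2 : ιP → PBond P j → PBond P j → ℝ)
    (hk : ∀ p q, 0 ≤ kP p q) (hg : ∀ p, 0 ≤ gP p)
    (b b' : PBond P j) (v v' : Fin 3 → ℝ) (U V W Z : GaugeField P j (Matrix.specialUnitaryGroup (Fin 2) ℂ))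
    (hVU : ∀ e, e ≠ b → V e = U e) (hVb : V b = U b * expPt v) (hWU : ∀ e, e ≠ b' → W e = U e) (hWb : W b' = U b' * expPt v')
    (hZV : ∀ e, e ≠ b' → Z e = V e) (hZb : Z b' = V b' * expPt v')
    (F₂ F₁₂ : ℝ → ℝ → ℝ) (α α' γ : ιP → ℝ → ℝ → ℝ)
    (hF0 : ∀ t ∈ Icc (0 : ℝ) 1, HasDerivWithinAt
      (fun t => RT (update (update U b (U b * expPt ((0 : ℝ) • v))) b' ((update U b (U b * expPt ((0 : ℝ) • v))) b' * expPt (t • v'))))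
      (F₂ 0 t) (Icc 0 1) t)
    (hF1 : ∀ t ∈ Icc (0 : ℝ) 1, HasDerivWithinAt
      (fun t => RT (update (update U b (U b * expPt ((1 : ℝ) • v))) b' ((update U b (U b * expPt ((1 : ℝ) • v))) b' * expPt (t • v'))))
      (F₂ 1 t) (Icc 0 1) t)
    (hF12 : ∀ t ∈ Icc (0 : ℝ) 1, ∀ s ∈ Icc (0 : ℝ) 1, HasDerivWithinAt (fun s => F₂ s t) (F₁₂ s t) (Icc 0 1) s)
    (hα : ∀ p, ∀ s ∈ Icc (0 : ℝ) 1, ∀ t ∈ Icc (0 : ℝ) 1, 0 ≤ α p s t ∧ α p s t ≤ KP p b * (‖v‖ / θc))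
    (hα' : ∀ q, ∀ s ∈ Icc (0 : ℝ) 1, ∀ t ∈ Icc (0 : ℝ) 1, 0 ≤ α' q s t ∧ α' q s t ≤ KP q b' * (‖v'‖ / θc))
    (hγ : ∀ p, ∀ s ∈ Icc (0 : ℝ) 1, ∀ t ∈ Icc (0 : ℝ) 1, 0 ≤ γ p s t ∧ γ p s t ≤ KP2 p b b' * (‖v‖ / θc) * (‖v'‖ / θc))
    (hbd : ∀ s ∈ Icc (0 : ℝ) 1, ∀ t ∈ Icc (0 : ℝ) 1, |F₁₂ s t| ≤ ∑ p, ∑ q, α p s t * kP p q * α' q s t + ∑ p, gP p * γ p s t) :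
    |RT Z - RT V - RT W + RT U| ≤
      (∑ p, ∑ q, KP p b * kP p q * KP q b' + ∑ p, gP p * KP2 p b b') * (‖v‖ / θc) * (‖v'‖ / θc) := by
  classical
  -- the relational corners ARE the square family's corners
  have hVeq : V = update U b (U b * expPt v) := eq_update_of_rel hVU hVb
  have hWeq : W = update U b' (U b' * expPt v') := eq_update_of_rel hWU hWb
  have hZeq : Z = update (update U b (U b * expPt v)) b' ((update U b (U b * expPt v)) b' * expPt v') := by
    have h := eq_update_of_rel hZV hZb
    rw [h, hVeq]
  -- the family as a real function of two variables
  set F : ℝ → ℝ → ℝ := fun s t =>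
    RT (update (update U b (U b * expPt (s • v))) b' ((update U b (U b * expPt (s • v))) b' * expPt (t • v'))) with hFdef
  have key := abs_rectDiff_le_curvLetters F F₂ F₁₂ (a := 1) (b := 1) zero_le_one zero_le_one hF0 hF1 hF12 kP gP α α' γ
    (fun p => KP p b * (‖v‖ / θc)) (fun q => KP q b' * (‖v'‖ / θc)) (fun p => KP2 p b b' * (‖v‖ / θc) * (‖v'‖ / θc))
    hk hg hα hα' hγ hbd
  -- identify the four corners
  have h11 : F 1 1 = RT Z := by rw [hFdef]; simp only []; rw [sqCorner_one_one, ← hZeq]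
  have h10 : F 1 0 = RT V := by rw [hFdef]; simp only []; rw [sqCorner_one_zero, ← hVeq]
  have h01 : F 0 1 = RT W := by rw [hFdef]; simp only []; rw [sqCorner_zero_one, ← hWeq]
  have h00 : F 0 0 = RT U := by rw [hFdef]; simp only []; rw [corner_zero_zero]
  rw [h11, h10, h01, h00, mul_one, mul_one, letterSum_sizes_eq] at key
  exact key

/-- The corner disjunction transported from the relational corners `(U V W Y)` to the square family's corners at `(U; B m; B′ m′)`. [folklore] -/
theorem corner_or_update_of_rel {P : Params} {j : ℕ}
    (B B' : PBond P j) (m m' : Fin 3 → ℝ) (U V W Y Xw : GaugeField P j (Matrix.specialUnitaryGroup (Fin 2) ℂ))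
    (hVU : ∀ e, e ≠ B → V e = U e) (hVb : V B = U B * expPt m) (hWU : ∀ e, e ≠ B' → W e = U e) (hWb : W B' = U B' * expPt m')
    (hYV : ∀ e, e ≠ B' → Y e = V e) (hYb : Y B' = V B' * expPt m')
    (hXwc : Xw = U ∨ Xw = V ∨ Xw = W ∨ Xw = Y) :
    Xw = U ∨ Xw = update U B (U B * expPt m) ∨ Xw = update U B' (U B' * expPt m') ∨
      Xw = update (update U B (U B * expPt m)) B' ((update U B (U B * expPt m)) B' * expPt m') := by
  classical
  have hVeq : V = update U B (U B * expPt m) := eq_update_of_rel hVU hVb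
  have hWeq : W = update U B' (U B' * expPt m') := eq_update_of_rel hWU hWb
  have hYeq : Y = update (update U B (U B * expPt m)) B' ((update U B (U B * expPt m)) B' * expPt m') := by
    have h := eq_update_of_rel hYV hYb
    rw [h, hVeq]
  rcases hXwc with h | h | h | h
  · exact Or.inl h
  · exact Or.inr (Or.inl (h.trans hVeq))
  · exact Or.inr (Or.inr (Or.inl (h.trans hWeq)))
  · exact Or.inr (Or.inr (Or.inr (h.trans hYeq)))

/-! ## §2 ★★ JT-E2E from corner stability, NEAR (I-curv) edition -/

/-- ★★ **JT-E2E FROM CORNER STABILITY, NEAR (I-curv) EDITION** (= ✓p819158 `jtBracket_of_cornerStability` with the curvature square clause (γ) stated ONLY for squares having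
the law point `Xw` among their corners — ONE added antecedent, TN-ICURV-FAR amendment A1 — plus `hXwc : Xw ∈ {U, V, W, Y}`; conclusion CHARACTER-EXACT).  THE (JT-h) CONJUNCT
TEXT of the frozen row at ONE admissible square `(U V W Y; B m; B′ m′)` and law point `Xw` a corner, for ONE real `t`, FROM: the frame∕chart facts (α); the four pair-local
corner-stability texts (β′); the NEAR differential curvature square clause of `h_Ts∘Φ(·,z)` on a measurable good set (γ-near); crude letter on `{ŵ ≠ 0}` + tail (δ).
Letter `kG + ES·kB`, `kG := Σ_{p q} KP p B·k̃ p q·KP q B′ + Σ_p g̃ p·KP2 p B B′`. [folklore] -/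
theorem jtBracket_of_cornerStability_near (F : T3Family) (γ b₀ p₀ : ℝ) (j Ts : ℕ) (hjTs : j + 1 ≤ Ts)
    (ρ ρ' : (i : ℕ) → GaugeField (F.P i) 0 ↥(Matrix.specialUnitaryGroup (Fin 2) ℂ) → ℝ)
    (hρm : Measurable (ρ Ts)) (hρ'm : Measurable (ρ' Ts))
    (hρc : ContinuousOn (ρ Ts) {U | PlaqSmall (θBal F.L γ b₀ p₀ Ts) U}) (hρ'c : ContinuousOn (ρ' Ts) {U | PlaqSmall (θBal F.L γ b₀ p₀ Ts) U})
    (hρpos : ∀ U, PlaqSmall (θBal F.L γ b₀ p₀ Ts) U → 0 < ρ Ts U ∧ 0 < ρ' Ts U)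
    (hθ : 0 < θBal F.L γ b₀ p₀ Ts) (hθj : 0 < θBal F.L γ b₀ p₀ j)
    (hχc : Continuous (mwCut F γ b₀ p₀ j Ts)) (hχ0 : ∀ U, 0 ≤ mwCut F γ b₀ p₀ j Ts U)
    (hχsupp : ∀ U, mwCut F γ b₀ p₀ j Ts U ≠ 0 → ∀ (n : ℕ) (hjn : j + 1 ≤ n) (hnK : n ≤ Ts), PlaqSmall (24 / 25 * θBal F.L γ b₀ p₀ n) (descendTo F ℰp n Ts hnK U))
    (hχpos : ∀ U, (∀ (n : ℕ) (hjn : j + 1 ≤ n) (hnK : n ≤ Ts), PlaqSmall (24 / 25 * θBal F.L γ b₀ p₀ n) (descendTo F ℰp n Ts hnK U)) → 0 < mwCut F γ b₀ p₀ j Ts U)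
    {Z : Type} [MeasurableSpace Z] (τ : Measure Z) [IsProbabilityMeasure τ]
    (Φ : GaugeField (F.P j) 0 ↥(Matrix.specialUnitaryGroup (Fin 2) ℂ) × Z → GaugeField (F.P Ts) 0 ↥(Matrix.specialUnitaryGroup (Fin 2) ℂ))
    (J : GaugeField (F.P j) 0 ↥(Matrix.specialUnitaryGroup (Fin 2) ℂ) × Z → ℝ≥0)
    (hΦm : Measurable Φ) (hJm : Measurable J) (CJ : ℝ) (hJle : ∀ V z, (J (V, z) : ℝ) ≤ CJ)
    (hpos : ∀ V, PlaqSmall (θBal F.L γ b₀ p₀ j) V →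
      0 < ∫⁻ z in {z | (∀ (n : ℕ) (hjn : j + 1 ≤ n) (hnK : n ≤ Ts), PlaqSmall (24 / 25 * θBal F.L γ b₀ p₀ n) (descendTo F ℰp n Ts hnK (Φ (V, z))))},
        (J (V, z) : ℝ≥0∞) ∂τ)
    (t : ℝ)
    -- (β′) CORNER STABILITY: the four PAIR-LOCAL square-stability texts at the corners w.r.t. the law point `Xw` — HYPOTHESES here
    {rc c : ℝ} (hc : c < 1)
    -- the square and the law point (a corner)
    (B B' : PBond (F.P j) 0) (m m' : Fin 3 → ℝ) (U V W Y Xw : GaugeField (F.P j) 0 ↥(Matrix.specialUnitaryGroup (Fin 2) ℂ))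
    (hm : ‖m‖ ≤ rc * (θBal F.L γ b₀ p₀ j / 4)) (hm' : ‖m'‖ ≤ rc * (θBal F.L γ b₀ p₀ j / 4))
    (hU : PlaqSmall (θBal F.L γ b₀ p₀ j / 4) U) (hV : PlaqSmall (θBal F.L γ b₀ p₀ j / 4) V) (hW : PlaqSmall (θBal F.L γ b₀ p₀ j / 4) W)
    (hY : PlaqSmall (θBal F.L γ b₀ p₀ j / 4) Y) (hXw : PlaqSmall (θBal F.L γ b₀ p₀ j / 4) Xw)
    (hVU : ∀ e, e ≠ B → V e = U e) (hVb : V B = U B * expPt m) (hWU : ∀ e, e ≠ B' → W e = U e) (hWb : W B' = U B' * expPt m')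
    (hYV : ∀ e, e ≠ B' → Y e = V e) (hYb : Y B' = V B' * expPt m')
    (hXwc : Xw = U ∨ Xw = V ∨ Xw = W ∨ Xw = Y)
    (hstabU : ∀ z, mwCut F γ b₀ p₀ j Ts (Φ (Xw, z)) ≠ 0 → ∀ p, dist1 (GaugeField.plaqHol (Φ (U, z)) p) ≤ c * θBal F.L γ b₀ p₀ Ts)
    (hstabV : ∀ z, mwCut F γ b₀ p₀ j Ts (Φ (Xw, z)) ≠ 0 → ∀ p, dist1 (GaugeField.plaqHol (Φ (V, z)) p) ≤ c * θBal F.L γ b₀ p₀ Ts)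
    (hstabW : ∀ z, mwCut F γ b₀ p₀ j Ts (Φ (Xw, z)) ≠ 0 → ∀ p, dist1 (GaugeField.plaqHol (Φ (W, z)) p) ≤ c * θBal F.L γ b₀ p₀ Ts)
    (hstabY : ∀ z, mwCut F γ b₀ p₀ j Ts (Φ (Xw, z)) ≠ 0 → ∀ p, dist1 (GaugeField.plaqHol (Φ (Y, z)) p) ≤ c * θBal F.L γ b₀ p₀ Ts)
    -- (γ-near) the curvature square clause of `h_Ts ∘ Φ(·, z)` on the good set, ONLY for squares with `Xw` among their corners (TN-ICURV-FAR A1 text)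
    {ιP : Type*} [Fintype ιP] (kP : ιP → ιP → ℝ) (gP : ιP → ℝ) (KP : ιP → PBond (F.P j) 0 → ℝ) (KP2 : ιP → PBond (F.P j) 0 → PBond (F.P j) 0 → ℝ)
    (hk : ∀ p q, 0 ≤ kP p q) (hg : ∀ p, 0 ≤ gP p) (hKP : ∀ p b, 0 ≤ KP p b) (hKP2 : ∀ p b b', 0 ≤ KP2 p b b')
    (Good : Set Z) (hGood : MeasurableSet Good)
    (hcurv : ∀ z ∈ Good, wgt F γ b₀ p₀ j Ts ρ ρ' τ Φ J t Xw z ≠ 0 →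
      ∀ (b b' : PBond (F.P j) 0) (v v' : Fin 3 → ℝ) (X : GaugeField (F.P j) 0 ↥(Matrix.specialUnitaryGroup (Fin 2) ℂ)),
      ‖v‖ ≤ rc * (θBal F.L γ b₀ p₀ j / 4) → ‖v'‖ ≤ rc * (θBal F.L γ b₀ p₀ j / 4) → PlaqSmall (θBal F.L γ b₀ p₀ j / 4) X →
      PlaqSmall (θBal F.L γ b₀ p₀ j / 4) (update X b (X b * expPt v)) → PlaqSmall (θBal F.L γ b₀ p₀ j / 4) (update X b' (X b' * expPt v')) →
      PlaqSmall (θBal F.L γ b₀ p₀ j / 4) (update (update X b (X b * expPt v)) b' ((update X b (X b * expPt v)) b' * expPt v')) →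
      (Xw = X ∨ Xw = update X b (X b * expPt v) ∨ Xw = update X b' (X b' * expPt v') ∨
        Xw = update (update X b (X b * expPt v)) b' ((update X b (X b * expPt v)) b' * expPt v')) →
      ∃ (F₂ F₁₂ : ℝ → ℝ → ℝ) (α α' γ' : ιP → ℝ → ℝ → ℝ),
        (∀ t' ∈ Icc (0 : ℝ) 1, HasDerivWithinAt
          (fun t' => (fun X' => Real.log (ρ Ts (Φ (X', z))) - Real.log (ρ' Ts (Φ (X', z))))
            (update (update X b (X b * expPt ((0 : ℝ) • v))) b' ((update X b (X b * expPt ((0 : ℝ) • v))) b' * expPt (t' • v'))))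
          (F₂ 0 t') (Icc 0 1) t') ∧
        (∀ t' ∈ Icc (0 : ℝ) 1, HasDerivWithinAt
          (fun t' => (fun X' => Real.log (ρ Ts (Φ (X', z))) - Real.log (ρ' Ts (Φ (X', z))))
            (update (update X b (X b * expPt ((1 : ℝ) • v))) b' ((update X b (X b * expPt ((1 : ℝ) • v))) b' * expPt (t' • v'))))
          (F₂ 1 t') (Icc 0 1) t') ∧
        (∀ t' ∈ Icc (0 : ℝ) 1, ∀ s ∈ Icc (0 : ℝ) 1, HasDerivWithinAt (fun s => F₂ s t') (F₁₂ s t') (Icc 0 1) s) ∧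
        (∀ p, ∀ s ∈ Icc (0 : ℝ) 1, ∀ t' ∈ Icc (0 : ℝ) 1, 0 ≤ α p s t' ∧ α p s t' ≤ KP p b * (‖v‖ / (θBal F.L γ b₀ p₀ j / 4))) ∧
        (∀ q, ∀ s ∈ Icc (0 : ℝ) 1, ∀ t' ∈ Icc (0 : ℝ) 1, 0 ≤ α' q s t' ∧ α' q s t' ≤ KP q b' * (‖v'‖ / (θBal F.L γ b₀ p₀ j / 4))) ∧
        (∀ p, ∀ s ∈ Icc (0 : ℝ) 1, ∀ t' ∈ Icc (0 : ℝ) 1,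
          0 ≤ γ' p s t' ∧ γ' p s t' ≤ KP2 p b b' * (‖v‖ / (θBal F.L γ b₀ p₀ j / 4)) * (‖v'‖ / (θBal F.L γ b₀ p₀ j / 4))) ∧
        (∀ s ∈ Icc (0 : ℝ) 1, ∀ t' ∈ Icc (0 : ℝ) 1,
          |F₁₂ s t'| ≤ ∑ p, ∑ q, α p s t' * kP p q * α' q s t' + ∑ p, gP p * γ' p s t'))
    -- (δ) crude letter on the law's support and tail of the good set
    {kB ES : ℝ} (hkB : 0 ≤ kB) (hES : 0 ≤ ES)
    (hcrude : ∀ z, wgt F γ b₀ p₀ j Ts ρ ρ' τ Φ J t Xw z ≠ 0 →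
      |(Real.log (ρ Ts (Φ (Y, z))) - Real.log (ρ' Ts (Φ (Y, z)))) - (Real.log (ρ Ts (Φ (V, z))) - Real.log (ρ' Ts (Φ (V, z))))
        - (Real.log (ρ Ts (Φ (W, z))) - Real.log (ρ' Ts (Φ (W, z)))) + (Real.log (ρ Ts (Φ (U, z))) - Real.log (ρ' Ts (Φ (U, z))))|
        ≤ kB * (‖m‖ / (θBal F.L γ b₀ p₀ j / 4)) * (‖m'‖ / (θBal F.L γ b₀ p₀ j / 4)))
    (htail : ∫ z in Goodᶜ, wgt F γ b₀ p₀ j Ts ρ ρ' τ Φ J t Xw z ∂τ ≤ ES) :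
    Integrable (fun z => (Real.log (ρ Ts (Φ (U, z))) - Real.log (ρ' Ts (Φ (U, z)))) * (wgt F γ b₀ p₀ j Ts ρ ρ' τ Φ J t) Xw z) τ ∧
    Integrable (fun z => (Real.log (ρ Ts (Φ (V, z))) - Real.log (ρ' Ts (Φ (V, z)))) * (wgt F γ b₀ p₀ j Ts ρ ρ' τ Φ J t) Xw z) τ ∧
    Integrable (fun z => (Real.log (ρ Ts (Φ (W, z))) - Real.log (ρ' Ts (Φ (W, z)))) * (wgt F γ b₀ p₀ j Ts ρ ρ' τ Φ J t) Xw z) τ ∧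
    Integrable (fun z => (Real.log (ρ Ts (Φ (Y, z))) - Real.log (ρ' Ts (Φ (Y, z)))) * (wgt F γ b₀ p₀ j Ts ρ ρ' τ Φ J t) Xw z) τ ∧
    |∫ z, ((Real.log (ρ Ts (Φ (Y, z))) - Real.log (ρ' Ts (Φ (Y, z)))) - (Real.log (ρ Ts (Φ (V, z))) - Real.log (ρ' Ts (Φ (V, z))))
      - (Real.log (ρ Ts (Φ (W, z))) - Real.log (ρ' Ts (Φ (W, z)))) + (Real.log (ρ Ts (Φ (U, z))) - Real.log (ρ' Ts (Φ (U, z)))))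
        * (wgt F γ b₀ p₀ j Ts ρ ρ' τ Φ J t) Xw z ∂τ|
      ≤ ((∑ p, ∑ q, KP p B * kP p q * KP q B' + ∑ p, gP p * KP2 p B B') + ES * kB)
        * (‖m‖ / (θBal F.L γ b₀ p₀ j / 4)) * (‖m'‖ / (θBal F.L γ b₀ p₀ j / 4)) := by
  classical
  -- abbreviations
  set θc : ℝ := θBal F.L γ b₀ p₀ j / 4 with hθc
  set ŵ : Z → ℝ := fun z => wgt F γ b₀ p₀ j Ts ρ ρ' τ Φ J t Xw z with hŵ
  have hθc0 : 0 < θc := by rw [hθc]; positivity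
  have hθc_le : θc ≤ θBal F.L γ b₀ p₀ j := by rw [hθc]; linarith
  have hXwj : PlaqSmall (θBal F.L γ b₀ p₀ j) Xw := fun p => lt_of_lt_of_le (hXw p) hθc_le
  -- (α) the law is a probability law with a non-negative density
  obtain ⟨_, hmass, hwi, hwn⟩ := wgt_normalised F γ b₀ p₀ j Ts hjTs ρ ρ' hρm hρ'm hρc hρ'c hρpos hθ hχc hχ0 hχsupp hχpos τ Φ J
    hΦm hJm CJ hJle hpos t Xw hXwj
  have hwnn : ∀ z, 0 ≤ ŵ z := fun z => wgt_interp_nonneg F γ b₀ p₀ j Ts ρ ρ' hρpos hθ hχ0 hχsupp hjTs τ Φ J t Xw hmass z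
  -- the four integrabilities (LEAD №17 ✓p815882) from the four corner-stability texts
  have hint : ∀ (X : GaugeField (F.P j) 0 ↥(Matrix.specialUnitaryGroup (Fin 2) ℂ)),
      (∀ z, mwCut F γ b₀ p₀ j Ts (Φ (Xw, z)) ≠ 0 → ∀ p, dist1 (GaugeField.plaqHol (Φ (X, z)) p) ≤ c * θBal F.L γ b₀ p₀ Ts) →
      Integrable (fun z => (Real.log (ρ Ts (Φ (X, z))) - Real.log (ρ' Ts (Φ (X, z)))) * wgt F γ b₀ p₀ j Ts ρ ρ' τ Φ J t Xw z) τ :=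
    fun X hX => (integrable_logRatio_mul_wgt_of_squareStability F γ b₀ p₀ j Ts hjTs ρ ρ' hρm hρ'm hρc hρ'c hρpos hθ hχc hχ0 hχsupp hχpos τ Φ J
      hΦm hJm CJ hJle hpos c hc t X Xw hXwj hX).1
  refine ⟨hint U hstabU, hint V hstabV, hint W hstabW, hint Y hstabY, ?_⟩
  -- the relational corners are the square family's corners at `(U; B m; B′ m′)`
  have hVeq : V = update U B (U B * expPt m) := eq_update_of_rel hVU hVb
  have hWeq : W = update U B' (U B' * expPt m') := eq_update_of_rel hWU hWb
  have hYeq : Y = update (update U B (U B * expPt m)) B' ((update U B (U B * expPt m)) B' * expPt m') := by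
    have h := eq_update_of_rel hYV hYb
    rw [h, hVeq]
  have hXwc' := corner_or_update_of_rel B B' m m' U V W Y Xw hVU hVb hWU hWb hYV hYb hXwc
  -- (γ-near) the good-set pointwise letter from the curvature square clause AT THE OBSERVABLE SQUARE
  set kG : ℝ := ∑ p, ∑ q, KP p B * kP p q * KP q B' + ∑ p, gP p * KP2 p B B' with hkG
  have hkG0 : 0 ≤ kG :=
    add_nonneg (Finset.sum_nonneg fun p _ => Finset.sum_nonneg fun q _ => mul_nonneg (mul_nonneg (hKP p B) (hk p q)) (hKP q B'))
      (Finset.sum_nonneg fun p _ => mul_nonneg (hg p) (hKP2 p B B'))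
  have hsz : 0 ≤ ‖m‖ / θc := div_nonneg (norm_nonneg _) hθc0.le
  have hsz' : 0 ≤ ‖m'‖ / θc := div_nonneg (norm_nonneg _) hθc0.le
  have hG : ∀ z ∈ Good, ŵ z ≠ 0 →
      |(Real.log (ρ Ts (Φ (Y, z))) - Real.log (ρ' Ts (Φ (Y, z)))) - (Real.log (ρ Ts (Φ (V, z))) - Real.log (ρ' Ts (Φ (V, z))))
        - (Real.log (ρ Ts (Φ (W, z))) - Real.log (ρ' Ts (Φ (W, z)))) + (Real.log (ρ Ts (Φ (U, z))) - Real.log (ρ' Ts (Φ (U, z))))|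
        ≤ kG * (‖m‖ / θc) * (‖m'‖ / θc) := by
    intro z hzG hzw
    obtain ⟨F₂, F₁₂, α, α', γ', hF0, hF1, hF12, hα, hα', hγ, hbd⟩ :=
      hcurv z hzG hzw B B' m m' U hm hm' hU (hVeq ▸ hV) (hWeq ▸ hW) (hYeq ▸ hY) hXwc'
    exact hClauseSq_of_curvData (fun X' => Real.log (ρ Ts (Φ (X', z))) - Real.log (ρ' Ts (Φ (X', z)))) kP gP KP KP2 hk hg
      B B' m m' U V W Y hVU hVb hWU hWb hYV hYb F₂ F₁₂ α α' γ' hF0 hF1 hF12 hα hα' hγ hbd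
  -- (ε) integrate: JT-INT
  have hI := abs_integral_secondDiff_mul_le_good_add_tail τ
    (fun z => Real.log (ρ Ts (Φ (U, z))) - Real.log (ρ' Ts (Φ (U, z))))
    (fun z => Real.log (ρ Ts (Φ (V, z))) - Real.log (ρ' Ts (Φ (V, z))))
    (fun z => Real.log (ρ Ts (Φ (W, z))) - Real.log (ρ' Ts (Φ (W, z))))
    (fun z => Real.log (ρ Ts (Φ (Y, z))) - Real.log (ρ' Ts (Φ (Y, z))))
    ŵ Good hGood hwi hwnn hwn ES htail (kG * (‖m‖ / θc) * (‖m'‖ / θc)) (kB * (‖m‖ / θc) * (‖m'‖ / θc))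
    (mul_nonneg (mul_nonneg hkG0 hsz) hsz') (mul_nonneg (mul_nonneg hkB hsz) hsz') hG (fun z hz => hcrude z hz)
  have hfin := (secondDiff_letter_bound (I := ∫ z, ((Real.log (ρ Ts (Φ (Y, z))) - Real.log (ρ' Ts (Φ (Y, z))))
      - (Real.log (ρ Ts (Φ (V, z))) - Real.log (ρ' Ts (Φ (V, z)))) - (Real.log (ρ Ts (Φ (W, z))) - Real.log (ρ' Ts (Φ (W, z))))
      + (Real.log (ρ Ts (Φ (U, z))) - Real.log (ρ' Ts (Φ (U, z))))) * ŵ z ∂τ)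
    hkG0 hkB hES (by
      have e : kG * (‖m‖ / θc) * (‖m'‖ / θc) + kB * (‖m‖ / θc) * (‖m'‖ / θc) * ES
          = kG * (‖m‖ / θc) * (‖m'‖ / θc) + (kB * (‖m‖ / θc) * (‖m'‖ / θc)) * ES := by ring
      rw [e]; exact hI)).2
  exact hfin

/-! ## §3 ★★★ (JT-h)sq from the row's one-bond letter, NEAR (I-curv) edition -/

/-- ★★★ **(JT-h)sq FROM THE ROW's ONE-BOND LETTER, NEAR (I-curv) EDITION** (= ✓p819624 `jtBracket_sq_of_hdisp` with (γ) ↦ (γ-near)): the (JT-h) bracket of the frozen row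
at one admissible square with the law point a corner, from the frame facts (α), the row's `hdisp` text + uniform cap `Db` + near room `24∕25·θBal_Ts + 3·(Db·rc) ≤ c·θBal_Ts`,
the NEAR curvature square clause on the good set (γ-near), crude letter + tail (δ) (px20 ✓`hstab_corners_of_hdisp` ∘ ★★`jtBracket_of_cornerStability_near`).  This is the
knit-sq v0.2 (JT-h)sq line as ONE name. [folklore] -/
theorem jtBracket_sq_of_hdisp_near (F : T3Family) (γ b₀ p₀ : ℝ) (j Ts : ℕ) (hjTs : j + 1 ≤ Ts)
    (ρ ρ' : (i : ℕ) → GaugeField (F.P i) 0 ↥(Matrix.specialUnitaryGroup (Fin 2) ℂ) → ℝ)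
    (hρm : Measurable (ρ Ts)) (hρ'm : Measurable (ρ' Ts))
    (hρc : ContinuousOn (ρ Ts) {U | PlaqSmall (θBal F.L γ b₀ p₀ Ts) U}) (hρ'c : ContinuousOn (ρ' Ts) {U | PlaqSmall (θBal F.L γ b₀ p₀ Ts) U})
    (hρpos : ∀ U, PlaqSmall (θBal F.L γ b₀ p₀ Ts) U → 0 < ρ Ts U ∧ 0 < ρ' Ts U)
    (hθ : 0 < θBal F.L γ b₀ p₀ Ts) (hθj : 0 < θBal F.L γ b₀ p₀ j)
    (hχc : Continuous (mwCut F γ b₀ p₀ j Ts)) (hχ0 : ∀ U, 0 ≤ mwCut F γ b₀ p₀ j Ts U)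
    (hχsupp : ∀ U, mwCut F γ b₀ p₀ j Ts U ≠ 0 → ∀ (n : ℕ) (hjn : j + 1 ≤ n) (hnK : n ≤ Ts), PlaqSmall (24 / 25 * θBal F.L γ b₀ p₀ n) (descendTo F ℰp n Ts hnK U))
    (hχpos : ∀ U, (∀ (n : ℕ) (hjn : j + 1 ≤ n) (hnK : n ≤ Ts), PlaqSmall (24 / 25 * θBal F.L γ b₀ p₀ n) (descendTo F ℰp n Ts hnK U)) → 0 < mwCut F γ b₀ p₀ j Ts U)
    {Z : Type} [MeasurableSpace Z] (τ : Measure Z) [IsProbabilityMeasure τ]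
    (Φ : GaugeField (F.P j) 0 ↥(Matrix.specialUnitaryGroup (Fin 2) ℂ) × Z → GaugeField (F.P Ts) 0 ↥(Matrix.specialUnitaryGroup (Fin 2) ℂ))
    (J : GaugeField (F.P j) 0 ↥(Matrix.specialUnitaryGroup (Fin 2) ℂ) × Z → ℝ≥0)
    (hΦm : Measurable Φ) (hJm : Measurable J) (CJ : ℝ) (hJle : ∀ V z, (J (V, z) : ℝ) ≤ CJ)
    (hpos : ∀ V, PlaqSmall (θBal F.L γ b₀ p₀ j) V →
      0 < ∫⁻ z in {z | (∀ (n : ℕ) (hjn : j + 1 ≤ n) (hnK : n ≤ Ts), PlaqSmall (24 / 25 * θBal F.L γ b₀ p₀ n) (descendTo F ℰp n Ts hnK (Φ (V, z))))},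
        (J (V, z) : ℝ≥0∞) ∂τ)
    (t : ℝ)
    {rc c : ℝ} (hc : c < 1)
    -- the square and the law point
    (B B' : PBond (F.P j) 0) (m m' : Fin 3 → ℝ) (U V W Y Xw : GaugeField (F.P j) 0 ↥(Matrix.specialUnitaryGroup (Fin 2) ℂ))
    (hm : ‖m‖ ≤ rc * (θBal F.L γ b₀ p₀ j / 4)) (hm' : ‖m'‖ ≤ rc * (θBal F.L γ b₀ p₀ j / 4))
    (hU : PlaqSmall (θBal F.L γ b₀ p₀ j / 4) U) (hV : PlaqSmall (θBal F.L γ b₀ p₀ j / 4) V) (hW : PlaqSmall (θBal F.L γ b₀ p₀ j / 4) W)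
    (hY : PlaqSmall (θBal F.L γ b₀ p₀ j / 4) Y) (hXw : PlaqSmall (θBal F.L γ b₀ p₀ j / 4) Xw)
    (hVU : ∀ e, e ≠ B → V e = U e) (hVb : V B = U B * expPt m) (hWU : ∀ e, e ≠ B' → W e = U e) (hWb : W B' = U B' * expPt m')
    (hYV : ∀ e, e ≠ B' → Y e = V e) (hYb : Y B' = V B' * expPt m')
    -- (β-sq) the ROW's one-bond displacement text `hdisp`, uniform cap, NEAR room `3·Db·rc`, law point a CORNER
    (Db : ℝ) (hrc0 : 0 ≤ rc) (hDb0 : 0 ≤ Db) (DP : Plaq (F.P Ts) 0 → PBond (F.P j) 0 → ℝ) (hDb : ∀ p b, DP p b ≤ Db)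
    (hdisp : ∀ (z : Z) (X : GaugeField (F.P j) 0 ↥(Matrix.specialUnitaryGroup (Fin 2) ℂ)), PlaqSmall (θBal F.L γ b₀ p₀ j) X →
      ∀ (b : PBond (F.P j) 0) (v : Fin 3 → ℝ), ‖v‖ ≤ rc * (θBal F.L γ b₀ p₀ j / 4) → ∀ s ∈ Icc (0 : ℝ) 1, ∀ p : Plaq (F.P Ts) 0,
        dist1 (GaugeField.plaqHol (Φ (update X b (X b * expPt (s • v)), z)) p)
          ≤ dist1 (GaugeField.plaqHol (Φ (X, z)) p) + DP p b * (‖v‖ / (θBal F.L γ b₀ p₀ j / 4)))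
    (hroom : 24 / 25 * θBal F.L γ b₀ p₀ Ts + 3 * (Db * rc) ≤ c * θBal F.L γ b₀ p₀ Ts)
    (hXwc : Xw = U ∨ Xw = V ∨ Xw = W ∨ Xw = Y)
    -- (γ-near) the curvature square clause of `h_Ts ∘ Φ(·, z)` on the good set, ONLY for squares with `Xw` among their corners (TN-ICURV-FAR A1 text)
    {ιP : Type*} [Fintype ιP] (kP : ιP → ιP → ℝ) (gP : ιP → ℝ) (KP : ιP → PBond (F.P j) 0 → ℝ) (KP2 : ιP → PBond (F.P j) 0 → PBond (F.P j) 0 → ℝ)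
    (hk : ∀ p q, 0 ≤ kP p q) (hg : ∀ p, 0 ≤ gP p) (hKP : ∀ p b, 0 ≤ KP p b) (hKP2 : ∀ p b b', 0 ≤ KP2 p b b')
    (Good : Set Z) (hGood : MeasurableSet Good)
    (hcurv : ∀ z ∈ Good, wgt F γ b₀ p₀ j Ts ρ ρ' τ Φ J t Xw z ≠ 0 →
      ∀ (b b' : PBond (F.P j) 0) (v v' : Fin 3 → ℝ) (X : GaugeField (F.P j) 0 ↥(Matrix.specialUnitaryGroup (Fin 2) ℂ)),
      ‖v‖ ≤ rc * (θBal F.L γ b₀ p₀ j / 4) → ‖v'‖ ≤ rc * (θBal F.L γ b₀ p₀ j / 4) → PlaqSmall (θBal F.L γ b₀ p₀ j / 4) X →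
      PlaqSmall (θBal F.L γ b₀ p₀ j / 4) (update X b (X b * expPt v)) → PlaqSmall (θBal F.L γ b₀ p₀ j / 4) (update X b' (X b' * expPt v')) →
      PlaqSmall (θBal F.L γ b₀ p₀ j / 4) (update (update X b (X b * expPt v)) b' ((update X b (X b * expPt v)) b' * expPt v')) →
      (Xw = X ∨ Xw = update X b (X b * expPt v) ∨ Xw = update X b' (X b' * expPt v') ∨
        Xw = update (update X b (X b * expPt v)) b' ((update X b (X b * expPt v)) b' * expPt v')) →
      ∃ (F₂ F₁₂ : ℝ → ℝ → ℝ) (α α' γ' : ιP → ℝ → ℝ → ℝ),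
        (∀ t' ∈ Icc (0 : ℝ) 1, HasDerivWithinAt
          (fun t' => (fun X' => Real.log (ρ Ts (Φ (X', z))) - Real.log (ρ' Ts (Φ (X', z))))
            (update (update X b (X b * expPt ((0 : ℝ) • v))) b' ((update X b (X b * expPt ((0 : ℝ) • v))) b' * expPt (t' • v'))))
          (F₂ 0 t') (Icc 0 1) t') ∧
        (∀ t' ∈ Icc (0 : ℝ) 1, HasDerivWithinAt
          (fun t' => (fun X' => Real.log (ρ Ts (Φ (X', z))) - Real.log (ρ' Ts (Φ (X', z))))
            (update (update X b (X b * expPt ((1 : ℝ) • v))) b' ((update X b (X b * expPt ((1 : ℝ) • v))) b' * expPt (t' • v'))))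
          (F₂ 1 t') (Icc 0 1) t') ∧
        (∀ t' ∈ Icc (0 : ℝ) 1, ∀ s ∈ Icc (0 : ℝ) 1, HasDerivWithinAt (fun s => F₂ s t') (F₁₂ s t') (Icc 0 1) s) ∧
        (∀ p, ∀ s ∈ Icc (0 : ℝ) 1, ∀ t' ∈ Icc (0 : ℝ) 1, 0 ≤ α p s t' ∧ α p s t' ≤ KP p b * (‖v‖ / (θBal F.L γ b₀ p₀ j / 4))) ∧
        (∀ q, ∀ s ∈ Icc (0 : ℝ) 1, ∀ t' ∈ Icc (0 : ℝ) 1, 0 ≤ α' q s t' ∧ α' q s t' ≤ KP q b' * (‖v'‖ / (θBal F.L γ b₀ p₀ j / 4))) ∧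
        (∀ p, ∀ s ∈ Icc (0 : ℝ) 1, ∀ t' ∈ Icc (0 : ℝ) 1,
          0 ≤ γ' p s t' ∧ γ' p s t' ≤ KP2 p b b' * (‖v‖ / (θBal F.L γ b₀ p₀ j / 4)) * (‖v'‖ / (θBal F.L γ b₀ p₀ j / 4))) ∧
        (∀ s ∈ Icc (0 : ℝ) 1, ∀ t' ∈ Icc (0 : ℝ) 1,
          |F₁₂ s t'| ≤ ∑ p, ∑ q, α p s t' * kP p q * α' q s t' + ∑ p, gP p * γ' p s t'))
    -- (δ) crude letter on the law's support and tail of the good set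
    {kB ES : ℝ} (hkB : 0 ≤ kB) (hES : 0 ≤ ES)
    (hcrude : ∀ z, wgt F γ b₀ p₀ j Ts ρ ρ' τ Φ J t Xw z ≠ 0 →
      |(Real.log (ρ Ts (Φ (Y, z))) - Real.log (ρ' Ts (Φ (Y, z)))) - (Real.log (ρ Ts (Φ (V, z))) - Real.log (ρ' Ts (Φ (V, z))))
        - (Real.log (ρ Ts (Φ (W, z))) - Real.log (ρ' Ts (Φ (W, z)))) + (Real.log (ρ Ts (Φ (U, z))) - Real.log (ρ' Ts (Φ (U, z))))|
        ≤ kB * (‖m‖ / (θBal F.L γ b₀ p₀ j / 4)) * (‖m'‖ / (θBal F.L γ b₀ p₀ j / 4)))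
    (htail : ∫ z in Goodᶜ, wgt F γ b₀ p₀ j Ts ρ ρ' τ Φ J t Xw z ∂τ ≤ ES) :
    Integrable (fun z => (Real.log (ρ Ts (Φ (U, z))) - Real.log (ρ' Ts (Φ (U, z)))) * (wgt F γ b₀ p₀ j Ts ρ ρ' τ Φ J t) Xw z) τ ∧
    Integrable (fun z => (Real.log (ρ Ts (Φ (V, z))) - Real.log (ρ' Ts (Φ (V, z)))) * (wgt F γ b₀ p₀ j Ts ρ ρ' τ Φ J t) Xw z) τ ∧
    Integrable (fun z => (Real.log (ρ Ts (Φ (W, z))) - Real.log (ρ' Ts (Φ (W, z)))) * (wgt F γ b₀ p₀ j Ts ρ ρ' τ Φ J t) Xw z) τ ∧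
    Integrable (fun z => (Real.log (ρ Ts (Φ (Y, z))) - Real.log (ρ' Ts (Φ (Y, z)))) * (wgt F γ b₀ p₀ j Ts ρ ρ' τ Φ J t) Xw z) τ ∧
    |∫ z, ((Real.log (ρ Ts (Φ (Y, z))) - Real.log (ρ' Ts (Φ (Y, z)))) - (Real.log (ρ Ts (Φ (V, z))) - Real.log (ρ' Ts (Φ (V, z))))
      - (Real.log (ρ Ts (Φ (W, z))) - Real.log (ρ' Ts (Φ (W, z)))) + (Real.log (ρ Ts (Φ (U, z))) - Real.log (ρ' Ts (Φ (U, z)))))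
        * (wgt F γ b₀ p₀ j Ts ρ ρ' τ Φ J t) Xw z ∂τ|
      ≤ ((∑ p, ∑ q, KP p B * kP p q * KP q B' + ∑ p, gP p * KP2 p B B') + ES * kB)
        * (‖m‖ / (θBal F.L γ b₀ p₀ j / 4)) * (‖m'‖ / (θBal F.L γ b₀ p₀ j / 4)) := by
  have hst := hstab_corners_of_hdisp F γ b₀ p₀ j Ts hjTs hχsupp Φ hθj c Db rc hrc0 hDb0 DP hDb hdisp hroom
  exact jtBracket_of_cornerStability_near F γ b₀ p₀ j Ts hjTs ρ ρ' hρm hρ'm hρc hρ'c hρpos hθ hθj hχc hχ0 hχsupp hχpos τ Φ J hΦm hJm CJ hJle hpos t hc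
    B B' m m' U V W Y Xw hm hm' hU hV hW hY hXw hVU hVb hWU hWb hYV hYb hXwc
    (fun z hz p => hst z B B' m m' U V W Y hm hm' hU hV hW hY hVU hVb hWU hWb hYV hYb U Xw (Or.inl rfl) hXwc hz p)
    (fun z hz p => hst z B B' m m' U V W Y hm hm' hU hV hW hY hVU hVb hWU hWb hYV hYb V Xw (Or.inr (Or.inl rfl)) hXwc hz p)
    (fun z hz p => hst z B B' m m' U V W Y hm hm' hU hV hW hY hVU hVb hWU hWb hYV hYb W Xw (Or.inr (Or.inr (Or.inl rfl))) hXwc hz p)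
    (fun z hz p => hst z B B' m m' U V W Y hm hm' hU hV hW hY hVU hVb hWU hWb hYV hYb Y Xw (Or.inr (Or.inr (Or.inr rfl))) hXwc hz p)
    kP gP KP KP2 hk hg hKP hKP2 Good hGood hcurv hkB hES hcrude htail

end Summit.QuantumFields.YangMills.Theorems.OrganTangentJTSqOfHdispNear

end
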